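import Summits.QuantumFields.QCD.Theses.NestedDissectionSea
import Summits.QuantumFields.QCD.Theorems.EarlyCrosserLaw.Negative.CellPositivityDomain
import Summits.QuantumFields.QCD.Theorems.NestedDissectionSeaEarlyCrosserLawStubCrossingCharge
import Literature.MathematicalPhysics.QuantumFieldTheory.QCDPhaseQuenched
import Mathlib

/-!
# Stub `stub_excessRegular` of line `accretive-coarse-jensen`
(crux `Summit.QuantumFields.QCD.Theses.NestedDissectionSea.EarlyCrosserLaw`,
item stmt-QuantumFields-13995)

## What is proved

Let `M_U := wilsonCell U 0 x s` be the massless Dirichlet cell matrix of the box `(x, s)` (an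
`n × n` complex matrix, `n = Fintype.card {p // wilsonBox x s p}`) and `p_U := M_U.charpoly`.
For a centre `c : ℝ` and a radius `ρ` write
`A_U(ρ) := Real.circleAverage (fun z ↦ Real.log ‖p_U.eval z‖) c ρ` for the circle average of
`log |p_U|`.  The registered stub `stub_excessRegular` is the *regularity of the two-circle
Jensen excess* `J_U := A_U(R) - A_U(r)` for `0 < r < R`:

* `U ↦ J_U` is a measurable function of the gauge field, and
* `0 ≤ J_U ≤ n · log (R / r)` for every gauge field `U`.

## Proof route

* **Bounds.**  By the root form of the circle average of `log |p|` for a monic polynomial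
  (`crossingCharge_circleAverage_log_norm_eval`, landed with the neighbouring stub
  `stub_crossingCharge`), `J_U = ∑_{u ∈ roots p_U} g(‖c - u‖)` with the per-root kernel
  `g(d) := (log R + log⁺ (d / R)) - (log r + log⁺ (d / r))` (`excessRegular_excess_eq_sum`).
  Each term lies in `[0, log (R / r)]` (`crossingCharge_kernel_nonneg`, `excessRegular_kernel_le`)
  and there are `natDegree p_U = n` roots counted with multiplicity
  (`Polynomial.Splits.natDegree_eq_card_roots`, `Matrix.charpoly_natDegree_eq_dim`).
* **Measurability.**  `circleAverage f c ρ = (2π)⁻¹ • ∫ θ in 0..2π, f (circleMap c ρ θ)`, and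
  the integrand
  `(U, θ) ↦ log ‖p_U.eval (circleMap c ρ θ)‖ = log ‖det (scalar (circleMap c ρ θ) - M_U)‖`
  (`Matrix.eval_charpoly`) is `log` of a jointly continuous function (`continuous_wilsonDirac`,
  `Continuous.matrix_det`), hence jointly Borel measurable (`excessRegular_measurable_integrand`);
  the parametric Bochner integral of a jointly (strongly) measurable function is measurable in
  the parameter (`MeasureTheory.StronglyMeasurable.integral_prod_right'`).

Sources: Jensen's formula for polynomials (folklore); Mathlib
`Mathlib/MeasureTheory/Integral/Prod.lean`, `Mathlib/MeasureTheory/Integral/CircleAverage.lean`.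
-/

noncomputable section

open scoped BigOperators Matrix ComplexConjugate
open Filter MeasureTheory
open Literature.MathematicalPhysics.QuantumLattice Literature.MathematicalPhysics.QuantumFieldTheory
  Literature.Probability.LatticeModels
open Summit.QuantumFields.QCD.Theses.NestedDissectionSea

namespace Summit.QuantumFields.QCD.Cruxes.EarlyCrosserLaw.AccretiveCoarseJensen

/-- Local notation: the colour group `SU(3)`. -/
local notation "𝔾" => Matrix.specialUnitaryGroup (Fin 3) ℂ

/-! ### Step 1: the per-root kernel is at most `log (R / r)` -/

/-- The per-root kernel `(log R + log⁺ (d / R)) - (log r + log⁺ (d / r))` is at most `log (R / r)`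
for `0 < r < R` and `0 ≤ d`. -/
theorem excessRegular_kernel_le {r R d : ℝ} (hr : 0 < r) (hrR : r < R) (hd : 0 ≤ d) :
    (Real.log R + Real.posLog (R⁻¹ * d)) - (Real.log r + Real.posLog (r⁻¹ * d))
      ≤ Real.log (R / r) := by
  have hR : 0 < R := hr.trans hrR
  rw [Real.log_div hR.ne' hr.ne']
  rcases hd.eq_or_lt with h0 | hdpos
  · rw [← h0, mul_zero, mul_zero, Real.posLog_zero, add_zero, add_zero]
  · rw [crossingCharge_log_add_posLog hR hdpos, crossingCharge_log_add_posLog hr hdpos]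
    have h2 : max (Real.log R) (Real.log d)
        ≤ max (Real.log r) (Real.log d) + (Real.log R - Real.log r) :=
      max_le (by linarith [le_max_left (Real.log r) (Real.log d)])
        (by linarith [le_max_right (Real.log r) (Real.log d), Real.log_le_log hr hrR.le])
    linarith

/-! ### Step 2: the two-circle Jensen excess of a monic polynomial in root form, and its bounds -/

/-- **Root form of the two-circle Jensen excess** of a monic complex polynomial `p`:
`A(R) - A(r) = ∑_{u ∈ roots p} [(log R + log⁺ (‖c - u‖/R)) - (log r + log⁺ (‖c - u‖/r))]`
for `0 < r < R`, where `A(ρ) := circleAverage (log ‖p.eval ·‖) c ρ`. -/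
theorem excessRegular_excess_eq_sum {p : Polynomial ℂ} (hp : p.Monic) (c : ℂ) {r R : ℝ}
    (hr : 0 < r) (hrR : r < R) :
    Real.circleAverage (fun z : ℂ => Real.log ‖p.eval z‖) c R
        - Real.circleAverage (fun z : ℂ => Real.log ‖p.eval z‖) c r
      = (p.roots.map fun u => (Real.log R + Real.posLog (R⁻¹ * ‖c - u‖))
          - (Real.log r + Real.posLog (r⁻¹ * ‖c - u‖))).sum := by
  rw [crossingCharge_circleAverage_log_norm_eval hp c (hr.trans hrR).ne',
    crossingCharge_circleAverage_log_norm_eval hp c hr.ne', Multiset.sum_map_sub]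

/-- **Deterministic two-sided bound on the two-circle Jensen excess** of a monic complex
polynomial `p`: `0 ≤ A(R) - A(r) ≤ natDegree p · log (R / r)` for `0 < r < R`. -/
theorem excessRegular_excess_bounds {p : Polynomial ℂ} (hp : p.Monic) (c : ℂ) {r R : ℝ}
    (hr : 0 < r) (hrR : r < R) :
    0 ≤ Real.circleAverage (fun z : ℂ => Real.log ‖p.eval z‖) c R
          - Real.circleAverage (fun z : ℂ => Real.log ‖p.eval z‖) c r ∧
      Real.circleAverage (fun z : ℂ => Real.log ‖p.eval z‖) c R
          - Real.circleAverage (fun z : ℂ => Real.log ‖p.eval z‖) c r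
        ≤ (p.natDegree : ℝ) * Real.log (R / r) := by
  rw [excessRegular_excess_eq_sum hp c hr hrR]
  refine ⟨?_, ?_⟩
  · apply Multiset.sum_nonneg
    intro t ht
    rw [Multiset.mem_map] at ht
    obtain ⟨u, -, rfl⟩ := ht
    exact crossingCharge_kernel_nonneg hr hrR (norm_nonneg _)
  · refine (Multiset.sum_le_card_nsmul _ (Real.log (R / r)) ?_).trans_eq ?_
    · intro t ht
      rw [Multiset.mem_map] at ht
      obtain ⟨u, -, rfl⟩ := ht
      exact excessRegular_kernel_le hr hrR (norm_nonneg _)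
    · rw [Multiset.card_map, ← (IsAlgClosed.splits p).natDegree_eq_card_roots, nsmul_eq_mul]

/-! ### Step 3: measurability of the circle average as a function of the gauge field -/

/-- The integrand of the circle average, `(U, θ) ↦ p_U.eval (circleMap c ρ θ)` with
`p_U = charpoly (wilsonCell U 0 x s)`, is jointly continuous in the gauge field and the angle:
by `Matrix.eval_charpoly` it is the determinant of
`scalar (circleMap c ρ θ) - wilsonCell U 0 x s`, whose entries are continuous
(`continuous_wilsonDirac`, `continuous_circleMap`). -/
theorem excessRegular_continuous_eval {N : ℕ} [NeZero N] (x : TorusSite 4 N) (s : Fin 4 → ℕ)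
    (c : ℂ) (ρ : ℝ) :
    Continuous fun q : GaugeConfig 4 N 𝔾 × ℝ =>
      ((wilsonCell q.1 0 x s).charpoly).eval (circleMap c ρ q.2) := by
  simp_rw [Matrix.eval_charpoly]
  refine Continuous.matrix_det (continuous_matrix fun i j => ?_)
  simp only [Matrix.sub_apply, Matrix.scalar_apply, Matrix.diagonal_apply, wilsonCell,
    Matrix.toSquareBlockProp_def, Matrix.of_apply]
  refine Continuous.sub ?_ ?_
  · split_ifs
    · exact (continuous_circleMap c ρ).comp continuous_snd
    · exact continuous_const
  · exact ((continuous_wilsonDirac (fundamentalRep (Fin 3)) (continuous_fundamentalRep (Fin 3))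
      0 1).comp continuous_fst).matrix_elem _ _

/-- The integrand `(U, θ) ↦ log ‖p_U.eval (circleMap c ρ θ)‖` of the circle average is
jointly Borel measurable on `GaugeConfig × ℝ`. -/
theorem excessRegular_measurable_integrand {N : ℕ} [NeZero N] (x : TorusSite 4 N)
    (s : Fin 4 → ℕ) (c : ℂ) (ρ : ℝ) :
    Measurable fun q : GaugeConfig 4 N 𝔾 × ℝ =>
      Real.log ‖((wilsonCell q.1 0 x s).charpoly).eval (circleMap c ρ q.2)‖ :=
  (excessRegular_continuous_eval x s c ρ).norm.measurable.log

/-- **Measurability of the circle average of `log |p_U|` in the gauge field.**  For fixed cell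
data `(x, s)`, centre `c` and radius `ρ`, the map
`U ↦ circleAverage (log ‖(charpoly (wilsonCell U 0 x s)).eval ·‖) c ρ` is measurable
(parametric Bochner integral of a jointly measurable integrand). -/
theorem excessRegular_measurable_circleAverage {N : ℕ} [NeZero N] (x : TorusSite 4 N)
    (s : Fin 4 → ℕ) (c : ℂ) (ρ : ℝ) :
    Measurable fun U : GaugeConfig 4 N 𝔾 =>
      Real.circleAverage (fun z : ℂ => Real.log ‖((wilsonCell U 0 x s).charpoly).eval z‖)
        c ρ := by
  have hF : StronglyMeasurable fun q : GaugeConfig 4 N 𝔾 × ℝ =>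
      Real.log ‖((wilsonCell q.1 0 x s).charpoly).eval (circleMap c ρ q.2)‖ :=
    (excessRegular_measurable_integrand x s c ρ).stronglyMeasurable
  have h : StronglyMeasurable fun U : GaugeConfig 4 N 𝔾 =>
      ∫ θ in Set.Ioc 0 (2 * Real.pi),
        Real.log ‖((wilsonCell U 0 x s).charpoly).eval (circleMap c ρ θ)‖ :=
    hF.integral_prod_right'
  simp only [Real.circleAverage_def, intervalIntegral.integral_of_le Real.two_pi_pos.le,
    smul_eq_mul]
  exact h.measurable.const_mul _

/-! ### Step 4: the registered stub -/

/-- **Regularity of the two-circle Jensen excess** (registered stub `stub_excessRegular` of line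
`accretive-coarse-jensen`).  For fixed cell data `(x, s)`, centre `c` and radii `0 < r < R`, the
two-circle Jensen excess `J_U := A_U(R) - A_U(r)` of `log ‖charpoly (wilsonCell U 0 x s)‖`
(`A_U(ρ)` the circle average over the circle of radius `ρ` about `c`) is a measurable function of
the gauge field `U`, and `0 ≤ J_U ≤ n · log (R / r)` with
`n = Fintype.card {p // wilsonBox x s p}` the size of the cell: in root form each of the `n`
roots of the characteristic polynomial contributes an amount in `[0, log (R / r)]`. -/
theorem stub_excessRegular :
    ∀ (N : ℕ) [NeZero N] (x : TorusSite 4 N) (s : Fin 4 → ℕ) (c r R : ℝ), 0 < r → r < R →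
      (Measurable fun U : GaugeConfig 4 N 𝔾 =>
        Real.circleAverage (fun z : ℂ => Real.log ‖((wilsonCell U 0 x s).charpoly).eval z‖) (c : ℂ) R
          - Real.circleAverage (fun z : ℂ => Real.log ‖((wilsonCell U 0 x s).charpoly).eval z‖) (c : ℂ) r) ∧
      ∀ U : GaugeConfig 4 N 𝔾,
        0 ≤ Real.circleAverage (fun z : ℂ => Real.log ‖((wilsonCell U 0 x s).charpoly).eval z‖) (c : ℂ) R
              - Real.circleAverage (fun z : ℂ => Real.log ‖((wilsonCell U 0 x s).charpoly).eval z‖) (c : ℂ) r ∧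
        Real.circleAverage (fun z : ℂ => Real.log ‖((wilsonCell U 0 x s).charpoly).eval z‖) (c : ℂ) R
            - Real.circleAverage (fun z : ℂ => Real.log ‖((wilsonCell U 0 x s).charpoly).eval z‖) (c : ℂ) r ≤
          (Fintype.card {p // wilsonBox x s p} : ℝ) * Real.log (R / r) := by
  intro N _ x s c r R hr hrR
  refine ⟨(excessRegular_measurable_circleAverage x s (c : ℂ) R).sub
      (excessRegular_measurable_circleAverage x s (c : ℂ) r), fun U => ?_⟩
  have hmonic : (wilsonCell U 0 x s).charpoly.Monic := Matrix.charpoly_monic _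
  have hdeg : ((wilsonCell U 0 x s).charpoly.natDegree : ℝ)
      = Fintype.card {p // wilsonBox x s p} := by
    rw [Matrix.charpoly_natDegree_eq_dim]
  obtain ⟨h0, h1⟩ := excessRegular_excess_bounds hmonic (c : ℂ) hr hrR
  exact ⟨h0, hdeg ▸ h1⟩

end Summit.QuantumFields.QCD.Cruxes.EarlyCrosserLaw.AccretiveCoarseJensen

end
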